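import Summits.SmoothPoincare4.SmoothPoincare4.Theorems.SymplecticOrigamiGromovRecognitionRelEndHelperWindAtSimpleZero
import Mathlib.Analysis.InnerProductSpace.PiL2
import Mathlib.Analysis.InnerProductSpace.Continuous
import Mathlib.Analysis.Calculus.FDeriv.Add
import Mathlib.Analysis.Calculus.FDeriv.Mul
import Mathlib.Analysis.Calculus.FDeriv.Prod
import Mathlib.Analysis.Asymptotics.Lemmas
import Mathlib.Analysis.Normed.Operator.BoundedLinearMaps

/-!
# The local intersection index of a section of an oriented plane field at a transverse zero
(registered helper `helper_localIndexOfSection` of the stub `stub_normalWitnessTransfer`, line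
`cross-cap-laurent`, crux `GromovRecognitionRelEnd`, item stmt-SmoothPoincare4-11009)

Setting: over a disc `B(ζ₀, ρ) ⊆ ℂ` we are given a continuous oriented plane field on
`F := ℝᵐ × ℝ²`, presented by a projection `P z` and a quarter-turn `R z` (`R z ∘ R z = - P z`, the
coordinate formula in the frame `(v, R z v)`), with respect to the pairing
`B x y := ⟪x.1, y.1⟫ + ⟪x.2, y.2⟫; a continuous frame vector `t` (`P t = t ≠ 0`) and a continuous
section `w` of the plane field which vanishes at `ζ₀` and is differentiable there with injective
derivative `L₀` taking values in the plane at `ζ₀`.  The complex coordinate of `w` in the moving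
frame `(t, R t)` is `φ = B(w, t) + i B(w, R t)`, and `d` is the Jacobian determinant (in the real
basis `(1, i)`) of the linearised coordinate map `T h := B(L₀ h, t₀) + i B(L₀ h, R t₀)`,
`t₀ := t ζ₀`.

Claim (`helper_localIndexOfSection`): `d ≠ 0`, `ζ₀` is an isolated zero of `φ`, and on all small
circles about `ζ₀` the loop `φ ∘ circleLoop ζ₀ r` avoids `0` and winds `sign d`.  This is the
classical statement that the local intersection index of two transverse oriented surfaces is the
sign of the Jacobian of a local coordinate description (J. Milnor, *Topology from the
Differentiable Viewpoint* (1965), §6 Lemma 4), reduced here to the landed planar statement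
`helper_windAtSimpleZero`:
* `HelperLocalIndexOfSection.hasFDerivAt_inner_of_eq_zero` — product rule at a zero: if `f`
  vanishes at `z₀` and is differentiable there and `g` is merely continuous at `z₀`, then
  `z ↦ ⟪f z, g z⟫` is differentiable at `z₀` with derivative `h ↦ ⟪L h, g z₀⟫`
  (`⟪f z, g z - g z₀⟫ = O(‖z - z₀‖) · o(1)`, Landau calculus of `Mathlib.Analysis.Asymptotics`);
* hence `φ` has derivative `T` at `ζ₀` (`HelperLocalIndexOfSection.hasFDerivAt_coord`), and
  `det T = d` by `det_realLinear_complex_eq`;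
* `T` is injective: `T h = 0` makes both frame coordinates of `L₀ h` vanish, so `L₀ h = 0` by the
  coordinate formula of the plane field, and `h = 0` by injectivity of `L₀`; an injective
  real-linear endomorphism of `ℂ` has non-zero determinant, so `d ≠ 0`;
* `helper_windAtSimpleZero φ T ζ₀ ρ` gives isolation, non-vanishing and the winding number
  `if 0 < det T then 1 else -1`.

References: J. W. Milnor, *Topology from the Differentiable Viewpoint*, Univ. Press of Virginia
(1965), §6 Lemma 4 [MilnorTDV1965].  No new definitions.
-/

noncomputable section

open Set Function Filter Metric Asymptotics Literature.Topology.PlaneTopology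
open scoped Topology

-- the prescribed namespace `Summit.<P>.<Sub>.…` duplicates `SmoothPoincare4` (P = Sub)
set_option linter.dupNamespace false

namespace Summit.SmoothPoincare4.SmoothPoincare4.Theorems.GromovRecognitionRelEnd.CrossCapLaurent

namespace HelperLocalIndexOfSection

/-- **Product rule at a zero.** If `f` vanishes at `z₀` and has derivative `L` there, and `g` is
continuous at `z₀`, then `z ↦ ⟪f z, g z⟫` has derivative `h ↦ ⟪L h, g z₀⟫` at `z₀` (no
differentiability of `g` is needed, since `⟪f z, g z - g z₀⟫ = O(‖z - z₀‖) · o(1)`). [folklore] -/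
theorem hasFDerivAt_inner_of_eq_zero {E : Type*} [NormedAddCommGroup E] [InnerProductSpace ℝ E]
    {f g : ℂ → E} {L : ℂ →L[ℝ] E} {z₀ : ℂ} (hf : HasFDerivAt f L z₀) (hf0 : f z₀ = 0)
    (hg : ContinuousAt g z₀) {A : ℂ →L[ℝ] ℝ} (hA : ∀ h, A h = inner ℝ (L h) (g z₀)) :
    HasFDerivAt (fun z => inner ℝ (f z) (g z)) A z₀ := by
  refine HasFDerivAt.of_isLittleO ?_
  have h1 : (fun z => f z - f z₀ - L (z - z₀)) =o[𝓝 z₀] fun z => z - z₀ := hf.isLittleO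
  have h2 : (fun z => f z) =O[𝓝 z₀] fun z => z - z₀ := by
    simpa only [hf0, sub_zero] using hf.isBigO_sub
  have h3 : (fun z => g z - g z₀) =o[𝓝 z₀] fun _ => (1 : ℂ) :=
    (isLittleO_one_iff ℂ).2 (tendsto_sub_nhds_zero_iff.2 hg)
  have e1 : (fun z => inner ℝ (f z) (g z - g z₀)) =o[𝓝 z₀] fun z => z - z₀ := by
    have h4 : (fun z => ‖f z‖ * ‖g z - g z₀‖) =o[𝓝 z₀] fun z => (z - z₀) * 1 :=
      h2.norm_left.mul_isLittleO h3.norm_left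
    simp only [mul_one] at h4
    exact (IsBigO.of_norm_le fun z => norm_inner_le_norm (𝕜 := ℝ) (f z) (g z - g z₀)).trans_isLittleO
      h4
  have e2 : (fun z => inner ℝ (f z - f z₀ - L (z - z₀)) (g z₀)) =o[𝓝 z₀] fun z => z - z₀ := by
    have h5 : (fun z => ‖g z₀‖ * ‖f z - f z₀ - L (z - z₀)‖) =o[𝓝 z₀] fun z => z - z₀ :=
      h1.norm_left.const_mul_left _
    refine (IsBigO.of_norm_le fun z => ?_).trans_isLittleO h5
    rw [mul_comm]
    exact norm_inner_le_norm (𝕜 := ℝ) _ _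
  refine (e1.add e2).congr_left fun z => ?_
  rw [hA, inner_sub_right, inner_sub_left, inner_sub_left, hf0, inner_zero_left]
  ring

variable {E₁ E₂ : Type*} [NormedAddCommGroup E₁] [InnerProductSpace ℝ E₁] [NormedAddCommGroup E₂]
  [InnerProductSpace ℝ E₂]

/-- Product rule at a zero for the pairing `B x y = ⟪x.1, y.1⟫ + ⟪x.2, y.2⟫` on `E₁ × E₂`:
if `f z₀ = 0`, `f` has derivative `L` at `z₀` and `g` is continuous at `z₀`, then
`z ↦ B (f z) (g z)` has derivative `h ↦ B (L h) (g z₀)` at `z₀`. [folklore] -/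
theorem hasFDerivAt_pairing_of_eq_zero {f g : ℂ → E₁ × E₂} {L : ℂ →L[ℝ] E₁ × E₂} {z₀ : ℂ}
    (hf : HasFDerivAt f L z₀) (hf0 : f z₀ = 0) (hg : ContinuousAt g z₀) {A : ℂ →L[ℝ] ℝ}
    (hA : ∀ h, A h = inner ℝ (L h).1 (g z₀).1 + inner ℝ (L h).2 (g z₀).2) :
    HasFDerivAt (fun z => inner ℝ (f z).1 (g z).1 + inner ℝ (f z).2 (g z).2) A z₀ := by
  have h1 : HasFDerivAt (fun z => inner ℝ (f z).1 (g z).1)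
      ((innerSL ℝ (g z₀).1).comp ((ContinuousLinearMap.fst ℝ E₁ E₂).comp L)) z₀ :=
    hasFDerivAt_inner_of_eq_zero hf.fst (by simp [hf0]) hg.fst fun h => by
      simp only [ContinuousLinearMap.comp_apply, innerSL_apply_apply,
        ContinuousLinearMap.coe_fst']
      exact real_inner_comm _ _
  have h2 : HasFDerivAt (fun z => inner ℝ (f z).2 (g z).2)
      ((innerSL ℝ (g z₀).2).comp ((ContinuousLinearMap.snd ℝ E₁ E₂).comp L)) z₀ :=
    hasFDerivAt_inner_of_eq_zero hf.snd (by simp [hf0]) hg.snd fun h => by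
      simp only [ContinuousLinearMap.comp_apply, innerSL_apply_apply,
        ContinuousLinearMap.coe_snd']
      exact real_inner_comm _ _
  refine (h1.fun_add h2).congr_fderiv (ContinuousLinearMap.ext fun h => ?_)
  simp only [hA, add_apply, ContinuousLinearMap.comp_apply,
    innerSL_apply_apply, ContinuousLinearMap.coe_fst', ContinuousLinearMap.coe_snd']
  rw [real_inner_comm (L h).1, real_inner_comm (L h).2]

/-- The complex coordinate map `z ↦ B (f z) (g₁ z) + i B (f z) (g₂ z)` of a map `f` vanishing at
`z₀` with derivative `L` there, against two frames `g₁, g₂` continuous at `z₀`, has at `z₀` a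
real-linear derivative `T` with `T h = B (L h) (g₁ z₀) + i B (L h) (g₂ z₀)`. [folklore] -/
theorem hasFDerivAt_coord {f g₁ g₂ : ℂ → E₁ × E₂} {L : ℂ →L[ℝ] E₁ × E₂} {z₀ : ℂ}
    (hf : HasFDerivAt f L z₀) (hf0 : f z₀ = 0) (hg₁ : ContinuousAt g₁ z₀)
    (hg₂ : ContinuousAt g₂ z₀) :
    ∃ T : ℂ →L[ℝ] ℂ,
      (∀ h, T h = ((inner ℝ (L h).1 (g₁ z₀).1 + inner ℝ (L h).2 (g₁ z₀).2 : ℝ) : ℂ) +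
          ((inner ℝ (L h).1 (g₂ z₀).1 + inner ℝ (L h).2 (g₂ z₀).2 : ℝ) : ℂ) * Complex.I) ∧
        HasFDerivAt (fun z => ((inner ℝ (f z).1 (g₁ z).1 + inner ℝ (f z).2 (g₁ z).2 : ℝ) : ℂ) +
          ((inner ℝ (f z).1 (g₂ z).1 + inner ℝ (f z).2 (g₂ z).2 : ℝ) : ℂ) * Complex.I) T z₀ := by
  set A₁ : ℂ →L[ℝ] ℝ := (innerSL ℝ (g₁ z₀).1).comp ((ContinuousLinearMap.fst ℝ E₁ E₂).comp L) +
    (innerSL ℝ (g₁ z₀).2).comp ((ContinuousLinearMap.snd ℝ E₁ E₂).comp L) with hA₁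
  set A₂ : ℂ →L[ℝ] ℝ := (innerSL ℝ (g₂ z₀).1).comp ((ContinuousLinearMap.fst ℝ E₁ E₂).comp L) +
    (innerSL ℝ (g₂ z₀).2).comp ((ContinuousLinearMap.snd ℝ E₁ E₂).comp L) with hA₂
  have hA₁' : ∀ h, A₁ h = inner ℝ (L h).1 (g₁ z₀).1 + inner ℝ (L h).2 (g₁ z₀).2 := fun h => by
    simp only [hA₁, add_apply, ContinuousLinearMap.comp_apply,
      innerSL_apply_apply, ContinuousLinearMap.coe_fst', ContinuousLinearMap.coe_snd']
    rw [real_inner_comm (L h).1, real_inner_comm (L h).2]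
  have hA₂' : ∀ h, A₂ h = inner ℝ (L h).1 (g₂ z₀).1 + inner ℝ (L h).2 (g₂ z₀).2 := fun h => by
    simp only [hA₂, add_apply, ContinuousLinearMap.comp_apply,
      innerSL_apply_apply, ContinuousLinearMap.coe_fst', ContinuousLinearMap.coe_snd']
    rw [real_inner_comm (L h).1, real_inner_comm (L h).2]
  have h1 := hasFDerivAt_pairing_of_eq_zero hf hf0 hg₁ hA₁'
  have h2 := hasFDerivAt_pairing_of_eq_zero hf hf0 hg₂ hA₂'
  refine ⟨A₁.smulRight (1 : ℂ) + A₂.smulRight Complex.I, fun h => ?_, ?_⟩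
  · simp only [add_apply, ContinuousLinearMap.smulRight_apply, hA₁', hA₂',
      Complex.real_smul, mul_one]
  · simpa only [Complex.real_smul, mul_one] using
      (h1.smul_const (1 : ℂ)).fun_add (h2.smul_const Complex.I)

/-- An injective real-linear endomorphism of `ℂ` has non-zero determinant. [folklore] -/
theorem det_ne_zero_of_injective (T : ℂ →L[ℝ] ℂ) (hT : Injective T) :
    LinearMap.det (T : ℂ →ₗ[ℝ] ℂ) ≠ 0 := by
  have hinj : Injective (T : ℂ →ₗ[ℝ] ℂ) := hT
  have hbij : Bijective (T : ℂ →ₗ[ℝ] ℂ) := ⟨hinj, LinearMap.injective_iff_surjective.1 hinj⟩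
  exact ((LinearMap.isUnit_iff_isUnit_det _).1 ((Module.End.isUnit_iff _).2 hbij)).ne_zero

end HelperLocalIndexOfSection

open HelperLocalIndexOfSection in
/-- **Local intersection index of a section of an oriented plane field at a transverse zero.**
With the notation of the module docstring: `d ≠ 0`, the zero `ζ₀` of the frame coordinate
`φ = B(w, t) + i B(w, R t)` is isolated, and on every small circle about `ζ₀` the loop
`φ ∘ circleLoop ζ₀ r` avoids `0` and winds `+1` if `d > 0`, `-1` if `d < 0`.
[cite: MilnorTDV1965, §6 Lemma 4] -/
theorem helper_localIndexOfSection : ∀ (m : ℕ) (P R : ℂ → (EuclideanSpace ℝ (Fin m) × EuclideanSpace ℝ (Fin 2)) →L[ℝ] (EuclideanSpace ℝ (Fin m) × EuclideanSpace ℝ (Fin 2))) (t w : ℂ → EuclideanSpace ℝ (Fin m) × EuclideanSpace ℝ (Fin 2)) (φ : ℂ → ℂ) (L₀ : ℂ →L[ℝ] EuclideanSpace ℝ (Fin m) × EuclideanSpace ℝ (Fin 2)) (ζ₀ : ℂ) (ρ d : ℝ), 0 < ρ → ContinuousOn P (Metric.ball ζ₀ ρ) → ContinuousOn R (Metric.ball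 ζ₀ ρ) → ContinuousOn t (Metric.ball ζ₀ ρ) → ContinuousOn w (Metric.ball ζ₀ ρ) → (∀ z ∈ Metric.ball ζ₀ ρ, (∀ v, P z (P z v) = P z v) ∧ (∀ v, P z (R z v) = R z v) ∧ (∀ v, R z (P z v) = R z v) ∧ (∀ v, R z (R z v) = - P z v) ∧ (∀ v, inner ℝ (R z v).1 (P z v).1 + inner ℝ (R z v).2 (P z v).2 = 0) ∧ (∀ v, inner ℝ (R z v).1 (R z v).1 + inner ℝ (R z v).2 (R z v).2 = inner ℝ (P z v).1 (P z v).1 + inner ℝ (P z v).2 (P z v).2) ∧ P z ≠ 0 ∧ (∀ v w', P z v = v → v ≠ 0 → P z w' = w' → w' = ((inner ℝ w'.1 v.1 + inner ℝ w'.2 v.2) / (inner ℝ v.1 v.1 + inner ℝ v.2 v.2)) • v + ((inner ℝ w'.1 (R z v).1 + inner ℝ w'.2 (R z v).2) / (inner ℝ v.1 v.1 + inner ℝ v.2 v.2)) • R z v)) → (∀ z ∈ Metric.ball ζ₀ ρ, P z (t z) = t z ∧ t z ≠ 0 ∧ P z (w z) = w z) → (∀ z, φ z = ((inner ℝ (w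 z).1 (t z).1 + inner ℝ (w z).2 (t z).2 : ℝ) : ℂ) + ((inner ℝ (w z).1 (R z (t z)).1 + inner ℝ (w z).2 (R z (t z)).2 : ℝ) : ℂ) * Complex.I) → HasFDerivAt w L₀ ζ₀ → w ζ₀ = 0 → Function.Injective L₀ → (∀ h, P ζ₀ (L₀ h) = L₀ h) → d = (inner ℝ (L₀ 1).1 (t ζ₀).1 + inner ℝ (L₀ 1).2 (t ζ₀).2) * (inner ℝ (L₀ Complex.I).1 (R ζ₀ (t ζ₀)).1 + inner ℝ (L₀ Complex.I).2 (R ζ₀ (t ζ₀)).2) - (inner ℝ (L₀ Complex.I).1 (t ζ₀).1 + inner ℝ (L₀ Complex.I).2 (t ζ₀).2) * (inner ℝ (L₀ 1).1 (R ζ₀ (t ζ₀)).1 + inner ℝ (L₀ 1).2 (R ζ₀ (t ζ₀)).2) → d ≠ 0 ∧ ∃ r₀ : ℝ, 0 < r₀ ∧ r₀ < ρ ∧ (∀ z : ℂ, 0 < dist z ζ₀ → dist z ζ₀ ≤ r₀ → φ z ≠ 0) ∧ ∀ r : ℝ, 0 < r → r ≤ r₀ → Literature.Topology.PlaneTopology.IsNonvanishingLoop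 (fun τ => φ (Literature.Topology.PlaneTopology.circleLoop ζ₀ r τ)) ∧ Literature.Topology.PlaneTopology.wind (fun τ => φ (Literature.Topology.PlaneTopology.circleLoop ζ₀ r τ)) = (if 0 < d then 1 else -1) := by
  intro m P R t w φ L₀ ζ₀ ρ d hρ _hP hR ht hw hax htw hφ hwd hw0 hL₀ hPL hd
  have hζ₀ : ζ₀ ∈ ball ζ₀ ρ := mem_ball_self hρ
  have hnhds : ball ζ₀ ρ ∈ 𝓝 ζ₀ := isOpen_ball.mem_nhds hζ₀
  -- `φ` is the explicit coordinate map
  obtain rfl : φ = fun z => ((inner ℝ (w z).1 (t z).1 + inner ℝ (w z).2 (t z).2 : ℝ) : ℂ) +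
      ((inner ℝ (w z).1 (R z (t z)).1 + inner ℝ (w z).2 (R z (t z)).2 : ℝ) : ℂ) * Complex.I :=
    funext hφ
  -- continuity of the rotated frame `z ↦ R z (t z)` and of `φ` on the ball
  have hRt : ContinuousOn (fun z => R z (t z)) (ball ζ₀ ρ) := hR.clm_apply ht
  have hφc : ContinuousOn (fun z => ((inner ℝ (w z).1 (t z).1 + inner ℝ (w z).2 (t z).2 : ℝ) : ℂ) +
      ((inner ℝ (w z).1 (R z (t z)).1 + inner ℝ (w z).2 (R z (t z)).2 : ℝ) : ℂ) * Complex.I)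
      (ball ζ₀ ρ) := by
    have ha : ContinuousOn (fun z => inner ℝ (w z).1 (t z).1 + inner ℝ (w z).2 (t z).2)
        (ball ζ₀ ρ) := (hw.fst.inner ht.fst).add (hw.snd.inner ht.snd)
    have hb : ContinuousOn
        (fun z => inner ℝ (w z).1 (R z (t z)).1 + inner ℝ (w z).2 (R z (t z)).2) (ball ζ₀ ρ) :=
      (hw.fst.inner hRt.fst).add (hw.snd.inner hRt.snd)
    exact (Complex.continuous_ofReal.comp_continuousOn ha).add
      ((Complex.continuous_ofReal.comp_continuousOn hb).mul continuousOn_const)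
  -- the derivative `T` of `φ` at `ζ₀`
  obtain ⟨T, hT, hφT⟩ := hasFDerivAt_coord (g₁ := t) (g₂ := fun z => R z (t z)) hwd hw0
    (ht.continuousAt hnhds) (hRt.continuousAt hnhds)
  -- `φ ζ₀ = 0`
  have hφ0 : (fun z => ((inner ℝ (w z).1 (t z).1 + inner ℝ (w z).2 (t z).2 : ℝ) : ℂ) +
      ((inner ℝ (w z).1 (R z (t z)).1 + inner ℝ (w z).2 (R z (t z)).2 : ℝ) : ℂ) * Complex.I)
      ζ₀ = 0 := by
    simp [hw0]
  -- `T` is injective, by the coordinate formula of the plane field at `ζ₀`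
  have hTinj : Injective T := by
    refine (injective_iff_map_eq_zero T).2 fun h hh => ?_
    rw [hT] at hh
    have hre := congrArg Complex.re hh
    have him := congrArg Complex.im hh
    simp only [Complex.add_re, Complex.ofReal_re, Complex.mul_re, Complex.I_re, mul_zero,
      Complex.ofReal_im, Complex.I_im, mul_one, sub_zero, add_zero, Complex.zero_re,
      Complex.add_im, Complex.mul_im, zero_add, Complex.zero_im] at hre him
    obtain ⟨-, -, -, -, -, -, -, hspan⟩ := hax ζ₀ hζ₀
    obtain ⟨ht0, htne, -⟩ := htw ζ₀ hζ₀
    have key := hspan (t ζ₀) (L₀ h) ht0 htne (hPL h)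
    rw [hre, him, zero_div, zero_smul, zero_smul, add_zero] at key
    exact (map_eq_zero_iff L₀ hL₀).1 key
  have hdet0 : LinearMap.det (T : ℂ →ₗ[ℝ] ℂ) ≠ 0 := det_ne_zero_of_injective T hTinj
  -- `det T = d`
  have hdetT : LinearMap.det (T : ℂ →ₗ[ℝ] ℂ) = d := by
    rw [det_realLinear_complex_eq, hd]
    simp only [ContinuousLinearMap.coe_coe, hT, Complex.add_re, Complex.ofReal_re, Complex.mul_re,
      Complex.I_re, mul_zero, Complex.ofReal_im, Complex.I_im, mul_one, sub_zero, add_zero,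
      Complex.add_im, Complex.mul_im, zero_add]
  have hd0 : d ≠ 0 := hdetT ▸ hdet0
  obtain ⟨r₀, hr₀, hr₀ρ, hiso, hwind⟩ := helper_windAtSimpleZero _ T ζ₀ ρ hρ hφc hφT hφ0 hdet0
  refine ⟨hd0, r₀, hr₀, hr₀ρ, hiso, fun r hr hrr => ?_⟩
  rw [← hdetT]
  exact hwind r hr hrr

end Summit.SmoothPoincare4.SmoothPoincare4.Theorems.GromovRecognitionRelEnd.CrossCapLaurent
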